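import Mathlib
import Summits.MatrixMultiplication.Statement
import Summits.MatrixMultiplication.MatrixMultiplication.Theorems.GraphEquationsSublogDial

/-!
# Graph equations — read-outs and the descent conjunct (M25g)

A READ-OUT of multiplier `φ` turns every graph-equation family of local exponent `m` with `N`
non-scalar products into a bilinear algorithm of rank `≤ φ m · N`.  The deflation tower is a read-out
with `φ m = 2·3^{m-1}` (`readOut_tower`, unconditional).  The census conjunct `LogDescent` follows from
ANY read-out of sub-exponential multiplier `φ m = 3^{o(m)}` (`logDescent_of_subexpReadOut`): on systems
of multiplicity `O(log n)` such a multiplier is `n^{o(1)}`.  So the descent half of the crux is exactly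
the question whether the exponential tower multiplier can be made sub-exponential (single arcs cannot:
NODE-g36 §2), or descent achieved otherwise.
-/

set_option linter.dupNamespace false

noncomputable section

open scoped BigOperators

namespace Summit.MatrixMultiplication.MatrixMultiplication.Theorems.GraphEquations

open MvPolynomial
open Literature.Computability.AlgebraicComplexity

/-- A read-out of multiplier `φ`. -/
def ReadOut (φ : ℕ → ℕ) : Prop :=
  ∀ m : ℕ, 1 ≤ m → ∀ n : ℕ, 1 ≤ n → ∀ (N T : ℕ) (t : Fin T → MvPolynomial (GraphVars n) ℂ),
    (∀ o, t o ∈ graphIdeal n) →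
    (∃ gs : List (MvPolynomial (GraphVars n) ℂ), IsNonscalarSeq gs ∧ gs.length ≤ N ∧
      ∀ o, t o ∈ freeSpan {q | q ∈ gs}) →
    (∀ q : Fin n × Fin n, generator n q ^ m ∈ Ideal.span (Set.range t)) →
    tensorRank (matMulTensor ℂ n n n) ≤ φ m * N

/-- **The deflation tower is a read-out of multiplier `2·3^{m-1}`** (unconditional). -/
theorem readOut_tower : ReadOut fun m => 2 * 3 ^ (m - 1) :=
  fun _ hm _ hn _ _ t ht hN hgen => tensorRank_le_towerMultiplier hm hn t ht hN hgen

/-- A read-out bounds the rank by `φ m · cost` on every correct system of membership exponent `m`. -/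
theorem ReadOut.tensorRank_le {φ : ℕ → ℕ} (hRO : ReadOut φ) {n : ℕ} (hn : 1 ≤ n) (E : EqSystem n)
    (hE : E.Correct) {m : ℕ} (hm : 1 ≤ m)
    (hmem : ∀ q : Fin n × Fin n, generator n q ^ m ∈
      Ideal.span (Set.range fun o : Fin E.tests.length => E.testPoly (E.tests.get o))) :
    tensorRank (matMulTensor ℂ n n n) ≤ φ m * E.cost := by
  obtain ⟨gs, hns, hlen, hfs⟩ := exists_isNonscalarSeq_tests E hE.1
  exact hRO m hm n hn _ _ _ (fun o => hE.testPoly_mem_graphIdeal' (List.get_mem E.tests o))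
    ⟨gs, hns, hlen, hfs⟩ hmem

/-- Sub-exponential multiplier: `φ m = 3^{o(m)}`. -/
def SubexpMultiplier (φ : ℕ → ℕ) : Prop :=
  ∀ ε : ℝ, 0 < ε → ∃ A : ℝ, ∀ m : ℕ, 1 ≤ m → (φ m : ℝ) ≤ A * ((3 : ℝ) ^ (m - 1)) ^ ε

/-- A bounded multiplier is sub-exponential. -/
theorem subexpMultiplier_of_bounded {φ : ℕ → ℕ} {B : ℕ} (h : ∀ m, φ m ≤ B) : SubexpMultiplier φ := by
  intro ε hε
  refine ⟨B, fun m _ => ?_⟩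
  have h1 : (1 : ℝ) ≤ ((3 : ℝ) ^ (m - 1)) ^ ε :=
    Real.one_le_rpow (one_le_pow₀ (by norm_num)) hε.le
  calc (φ m : ℝ) ≤ B := by exact_mod_cast h m
    _ = (B : ℝ) * 1 := (mul_one _).symm
    _ ≤ (B : ℝ) * ((3 : ℝ) ^ (m - 1)) ^ ε := mul_le_mul_of_nonneg_left h1 (Nat.cast_nonneg _)

/-- **A sub-exponential read-out on systems of logarithmic multiplicity gives `ω ≤ β`.** -/
theorem omega_le_of_subexpReadOut {φ : ℕ → ℕ} (hφ : SubexpMultiplier φ) (hRO : ReadOut φ)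
    {β : ℝ} {mseq : ℕ → ℕ} (hg : PolyGrowth mseq) (hs : EqAdmissibleSeq β mseq) :
    omega ℂ ≤ β := by
  obtain ⟨c, hc⟩ := hs
  obtain ⟨hm1, C, A', hA'⟩ := hg
  refine le_of_forall_gt_imp_ge_of_dense fun β' hβ' => ?_
  -- growth constant positivity: at `n = 1`, `1 ≤ 3^{m-1} ≤ A'`.
  have hA'pos : 0 < A' := by
    have h := hA' 1 le_rfl
    simp only [Nat.cast_one, Real.one_rpow, mul_one] at h
    exact lt_of_lt_of_le (by positivity) h
  set ε : ℝ := (β' - β) / max C 1 with hεdef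
  have hmaxpos : 0 < max C 1 := lt_of_lt_of_le one_pos (le_max_right _ _)
  have hε : 0 < ε := div_pos (sub_pos.2 hβ') hmaxpos
  have hCε : C * ε ≤ β' - β := by
    have h1 : C * ε ≤ max C 1 * ε := mul_le_mul_of_nonneg_right (le_max_left _ _) hε.le
    have h2 : max C 1 * ε = β' - β := by
      rw [hεdef]; field_simp
    linarith
  obtain ⟨A, hA⟩ := hφ ε hε
  have hmem : β' ∈ admissibleExponents ℂ := by
    change (fun n : ℕ => (tensorRank (matMulTensor ℂ n n n) : ℝ)) =O[Filter.atTop]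
      fun n : ℕ => (n : ℝ) ^ β'
    refine Asymptotics.IsBigO.of_bound (|A| * A' ^ ε * |c|) ?_
    filter_upwards [Filter.eventually_ge_atTop 1] with n hn
    obtain ⟨E, hE, hgen, hcost⟩ := hc n hn
    have h1 := hRO.tensorRank_le hn E hE (hm1 n) hgen
    rw [Real.norm_of_nonneg (Nat.cast_nonneg _),
      Real.norm_of_nonneg (Real.rpow_nonneg (Nat.cast_nonneg _) _)]
    have hnpos : (0 : ℝ) < n := by exact_mod_cast hn
    have hn1 : (1 : ℝ) ≤ n := by exact_mod_cast hn
    have h3 : (tensorRank (matMulTensor ℂ n n n) : ℝ) ≤ (φ (mseq n) : ℝ) * (E.cost : ℝ) := by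
      exact_mod_cast h1
    have hpow0 : (0 : ℝ) ≤ (3 : ℝ) ^ (mseq n - 1) := by positivity
    -- the multiplier along the sequence is `n^{o(1)}`
    have hφn : (φ (mseq n) : ℝ) ≤ |A| * A' ^ ε * (n : ℝ) ^ (β' - β) := by
      have h4 : ((3 : ℝ) ^ (mseq n - 1)) ^ ε ≤ (A' * (n : ℝ) ^ C) ^ ε :=
        Real.rpow_le_rpow hpow0 (hA' n hn) hε.le
      have h5 : (A' * (n : ℝ) ^ C) ^ ε = A' ^ ε * (n : ℝ) ^ (C * ε) := by
        rw [Real.mul_rpow hA'pos.le (Real.rpow_nonneg hnpos.le _), ← Real.rpow_mul hnpos.le]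
      have h6 : (n : ℝ) ^ (C * ε) ≤ (n : ℝ) ^ (β' - β) :=
        Real.rpow_le_rpow_of_exponent_le hn1 hCε
      have h7 : (0 : ℝ) ≤ A' ^ ε := Real.rpow_nonneg hA'pos.le _
      calc (φ (mseq n) : ℝ) ≤ A * ((3 : ℝ) ^ (mseq n - 1)) ^ ε := hA (mseq n) (hm1 n)
        _ ≤ |A| * ((3 : ℝ) ^ (mseq n - 1)) ^ ε :=
          mul_le_mul_of_nonneg_right (le_abs_self A) (Real.rpow_nonneg hpow0 _)
        _ ≤ |A| * (A' ^ ε * (n : ℝ) ^ (C * ε)) := by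
          rw [← h5]; exact mul_le_mul_of_nonneg_left h4 (abs_nonneg A)
        _ ≤ |A| * (A' ^ ε * (n : ℝ) ^ (β' - β)) :=
          mul_le_mul_of_nonneg_left (mul_le_mul_of_nonneg_left h6 h7) (abs_nonneg A)
        _ = |A| * A' ^ ε * (n : ℝ) ^ (β' - β) := by ring
    have hcost' : (E.cost : ℝ) ≤ |c| * (n : ℝ) ^ β :=
      hcost.trans (mul_le_mul_of_nonneg_right (le_abs_self c) (Real.rpow_nonneg hnpos.le _))
    have hsplit : (n : ℝ) ^ (β' - β) * (n : ℝ) ^ β = (n : ℝ) ^ β' := by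
      rw [← Real.rpow_add hnpos]; ring_nf
    have hK : (0 : ℝ) ≤ |A| * A' ^ ε * (n : ℝ) ^ (β' - β) := by positivity
    calc (tensorRank (matMulTensor ℂ n n n) : ℝ) ≤ (φ (mseq n) : ℝ) * (E.cost : ℝ) := h3
      _ ≤ (|A| * A' ^ ε * (n : ℝ) ^ (β' - β)) * (|c| * (n : ℝ) ^ β) :=
          mul_le_mul hφn hcost' (Nat.cast_nonneg _) hK
      _ = |A| * A' ^ ε * |c| * (n : ℝ) ^ β' := by rw [← hsplit]; ring
  exact csInf_le (admissibleExponents_bddBelow ℂ) hmem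

/-- **`LogDescent` from any sub-exponential read-out.** -/
theorem logDescent_of_subexpReadOut {φ : ℕ → ℕ} (hφ : SubexpMultiplier φ) (hRO : ReadOut φ) :
    LogDescent :=
  fun _ _ _ hg hs _ hβ' =>
    eqAdmissibleRed_of_omega_lt ((omega_le_of_subexpReadOut hφ hRO hg hs).trans_lt hβ')

/-- Hence: a sub-exponential read-out reduces the crux to `LogCompression` alone. -/
theorem multiplicityReduction_of_logCompression_of_subexpReadOut {φ : ℕ → ℕ}
    (hφ : SubexpMultiplier φ) (hRO : ReadOut φ) (hA : LogCompression) : MultiplicityReduction :=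
  multiplicityReduction_of_logCompression_of_logDescent hA (logDescent_of_subexpReadOut hφ hRO)

end Summit.MatrixMultiplication.MatrixMultiplication.Theorems.GraphEquations

end
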